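import Literature.MathematicalPhysics.QuantumFieldTheory.Balaban1983to89.Node00.Record13
import Literature.MathematicalPhysics.QuantumFieldTheory.Balaban1983to89.Node00.Record12BgRowAnalysis

/-!
# NODE 00 — ROW P11 AT THE STAGE-13 RECORD: the field `Provisos₁₃.bg` (`BgProvisoΛ` along `gOfRecord₁₃`) from [15] Thm 1 (per-scale reading, named fact) +
# the letter inequalities + the two displayed gauge clauses — the supplier shape the K0‴ socket reads

Cell `pub-ymgap`, seat `pub-ymgap-node00-def-P11` (R218 ∕ OPS-NOTE-16; the POSITIVE supplier of row P11; director-ym №131 (4), dag-lead WORDS-131 (2)–(3)).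
[III] = [Balaban1988Convergent]; [15] = [Balaban1985Variational]; [I] = [Balaban1987RG1].

HONEST FRAMING.  Bookkeeping at node00-def-T's Stage-13 record (`Node00/Record13.lean` v1.1: `Provisos₁₃.bg := BgProvisoΛ …`): the `bg` field's BODY, for every windowed run,
FROM the seat's FILE 2 `Node00/Record12BgRowAnalysis` (`bgProvisoΛ_UbgMSOfRecord_of_thm1Scaled`).  CONDITIONAL on (h15) the named fact `VariationalThm1Scaled F N B₃ a₀ a₁`
([15] Thm 1 (8), per-scale reading — a `Prop` hypothesis, NEVER asserted), on the letter inequalities between the record's numerics and print's constants `B₃, a₀, a₁`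
(displayed, dischargeable for a numerics FAMILY carrying them as parameters — node00-def-K0a `theta13OfNumerics`), and on the two DISPLAYED local-gauge clauses ((1.12) [I],
(2.38) [III]) at the minimiser = [15] Thm 1 (9)–(10) on print's cube class.  NOTHING of Bałaban asserted; K0″∕K0‴ NOT closed by this file; counts unmoved (typed 28∕28 ·
discharged 5∕28); one finite `𝕋⁴` torus family; not continuum ∕ OS ∕ mass gap ∕ Clay.  Theorems only.

WHAT IS PROVED.  ★ `Stage13Params.bg_of_thm1Scaled` — for `θ : Stage13Params F N` with `θ.Admissible`, residual §2 data of record (`θ.Rz = RzOfRecord F N`, K0b), the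
named fact, the numerics clauses along every windowed run (`0 < cR·ε_m ≤ a₁`, `B₃·cR·ε_m ≤ εreg ≤ a₀`, `B₃·cR·ε_m ≤ (1 − β)·α₀(g_m)`), and the two gauge clauses: the BODY of
`θ.Provisos₁₃.bg` — `∀ p n, n ≤ p.K → InInterval θ.γ n (gOfRecord₁₃ θ p) → BgProvisoΛ F N p.K (settingOfRecord₁₃ θ p) (θ.Rz p.K) θ.τ9.M n (suppOfRecord₁₃ θ p n) (UbgOfRecord₁₃ θ p n)`
(level `0`: def-R's `bgProvisoΛ_of_eq_zero`; level `n + 1`: `UbgOfRecord₁₃_succ` = def-R's `UbgMSOfRecord`, FILE 2 §7).  `Stage13Params.bg_numerics_of_letters` — the third numerics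
clause from `p₀ ≤ q₀`, `0 ≤ B₃·cR·A₀ ≤ (1 − β)·C₀` and `g_m² ≤ e⁻¹` along the window (FILE 2 §1 «proper restrictions on ε_j»).
-/

noncomputable section

open MeasureTheory
open scoped Matrix.Norms.L2Operator

namespace Literature.MathematicalPhysics.QuantumFieldTheory.Balaban1983to89.Node00

open T4Continuum B14.Eq218Concrete B15DeterminingSets B12RegularSpaces111 B14RegularSpaces234

variable {F : T4Family} {N : ℕ} [NeZero N]

/-- **★ ROW P11 AT THE STAGE-13 RECORD — the body of `Provisos₁₃.bg` from [15] Thm 1 (per-scale reading) + numerics + the two gauge clauses.**  For an admissible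
`θ : Stage13Params F N` whose residual §2 data are K0b's (`θ.Rz = RzOfRecord F N`, the unit recipe): along every run `p` and level `n ≤ K` whose history stays in `]0, γ]`,
`BgProvisoΛ` holds for the support and background maps of record — GIVEN (h15) `VariationalThm1Scaled F N B₃ a₀ a₁`; (hnum) `0 < cR·ε_m(g_m) ≤ a₁` and `B₃·cR·ε_m ≤ εreg`
for `m ≤ n`, (ha₀) `εreg ≤ a₀`; (hBα) `B₃·cR·ε_m ≤ (1 − β)·α₀(g_m)` for `1 ≤ m ≤ n` (`bg_numerics_of_letters`); (hloc) the (1.12) gauges on the cubes of every `X ⊆ Λ_j(s)` and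
(h238) the (2.38) layer-cube gauges on the (2.41) range, both at the minimiser of record for solvable retained `𝐖` — [15] Thm 1 (9)–(10), DISPLAYED.
[cite: Balaban1988Convergent, (2.27)–(2.28) p.259, (2.34)–(2.41) p.261; Balaban1985Variational, Thm 1 (8)–(10) p.279; Balaban1987RG1, (1.11)–(1.16) p.262] -/
theorem Stage13Params.bg_of_thm1Scaled (θ : Stage13Params F N) (hθ : θ.Admissible F N) (hRz : θ.Rz = RzOfRecord F N)
    {B₃ a₀ a₁ : ℝ} (h15 : VariationalThm1Scaled F N B₃ a₀ a₁) (ha₀ : θ.ν.εreg ≤ a₀)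
    (hnum : ∀ (p : B12.RunParams) (n : ℕ), n ≤ p.K → Step.InInterval θ.γ n (gOfRecord₁₃ F N θ p) → ∀ m, m ≤ n →
      0 < θ.s2.cR * epsOfRecord θ.ν (gOfRecord₁₃ F N θ p) m ∧ θ.s2.cR * epsOfRecord θ.ν (gOfRecord₁₃ F N θ p) m ≤ a₁ ∧
        B₃ * (θ.s2.cR * epsOfRecord θ.ν (gOfRecord₁₃ F N θ p) m) ≤ θ.ν.εreg)
    (hBα : ∀ (p : B12.RunParams) (n : ℕ), n ≤ p.K → Step.InInterval θ.γ n (gOfRecord₁₃ F N θ p) → ∀ m, 1 ≤ m → m ≤ n →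
      B₃ * (θ.s2.cR * epsOfRecord θ.ν (gOfRecord₁₃ F N θ p) m) ≤ (1 - θ.s2.βc) * (lfOfRecord₁₂ F N θ.toStage12Params).alpha0 (gOfRecord₁₃ F N θ p m))
    (hloc : ∀ (p : B12.RunParams) (n : ℕ), n ≤ p.K → Step.InInterval θ.γ n (gOfRecord₁₃ F N θ p) →
      ∀ (s : SeqOfRecord F θ.ν θ.τ9.M (gOfRecord₁₃ F N θ p) p.K n) (W : MSField (F.P p.K) (SU N)), W ∈ suppOfRecord₁₃ F N θ p n s →
      W ∈ solvableDom (avOfRecord F N p.K) (regMSOfRecord F N θ.ν p.K n s.Ω) (genSet s.Ω n) →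
      ∀ j, 1 ≤ j → j ≤ n → ∀ X : (Sect2.domSys (F.P p.K) θ.τ9.M j).Dom, Sect2.domSites (F.P p.K) θ.τ9.M j X ⊆ s.Λ j →
      ∀ C ∈ Sect2.cubesI θ.τ9.M j (Sect2.domSites (F.P p.K) θ.τ9.M j X), ∃ u : Site (F.P p.K) 0 → (MatA N)ˣ,
        (∀ x, u x ∈ (B12RegularSpaces111SpecialUnitary.suModel N).G) ∧ ∃ A : PBond (F.P p.K) 0 → MatA N,
        (∀ bd ∈ C.bonds, gaugeU u (fun b' => ιSU N (UbgMSOfRecord F N θ.ν θ.τ9.M (gOfRecord₁₃ F N θ p) p.K n s W b')) bd = expI ((F.P p.K).eta j) (A bd)) ∧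
        (∀ bd ∈ C.bonds, ‖A bd‖ < θ.s2.cB * (lfOfRecord₁₂ F N θ.toStage12Params).alpha0 (gOfRecord₁₃ F N θ p j)) ∧
        ∀ q ∈ C.dpairs, ‖grad ((F.P p.K).eta j) q.2.1 (fun y => A ⟨y, q.2.2⟩) q.1‖ < θ.s2.cB * (lfOfRecord₁₂ F N θ.toStage12Params).alpha0 (gOfRecord₁₃ F N θ p j))
    (h238 : ∀ (p : B12.RunParams) (n : ℕ), n ≤ p.K → Step.InInterval θ.γ n (gOfRecord₁₃ F N θ p) →
      ∀ (s : SeqOfRecord F θ.ν θ.τ9.M (gOfRecord₁₃ F N θ p) p.K n) (W : MSField (F.P p.K) (SU N)), W ∈ suppOfRecord₁₃ F N θ p n s →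
      W ∈ solvableDom (avOfRecord F N p.K) (regMSOfRecord F N θ.ν p.K n s.Ω) (genSet s.Ω n) →
      ∀ j, 1 ≤ j → j ≤ n → ∀ X : (Sect2.domSys (F.P p.K) θ.τ9.M j).Dom,
      Sect2.admB (F.P p.K) θ.ν θ.τ9.M (gOfRecord₁₃ F N θ p) s.Ω s.Λ j (Sect2.domSites (F.P p.K) θ.τ9.M j X) = true →
      CondII238 (B12RegularSpaces111SpecialUnitary.suModel N) (Sect2.frameMS (Sect2.Residual.unit (F.P p.K) (MatA N)) θ.τ9.M j (Sect2.domSites (F.P p.K) θ.τ9.M j X) s.Ω)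
        (MSConsts.ofParams (F.P p.K) θ.s2.βc θ.s2.B θ.s2.C θ.s2.Mr j) (fun m => (lfOfRecord₁₂ F N θ.toStage12Params).alpha0 (gOfRecord₁₃ F N θ p m))
        (fun b' => ιSU N (UbgMSOfRecord F N θ.ν θ.τ9.M (gOfRecord₁₃ F N θ p) p.K n s W b'))) :
    ∀ (p : B12.RunParams) (n : ℕ), n ≤ p.K → Step.InInterval θ.γ n (gOfRecord₁₃ F N θ p) →
      BgProvisoΛ F N p.K (settingOfRecord₁₃ F N θ p) (θ.Rz p.K) θ.τ9.M n (suppOfRecord₁₃ F N θ p n) (UbgOfRecord₁₃ F N θ p n) := by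
  intro p n hn hw
  rw [hRz]
  cases n with
  | zero => exact bgProvisoΛ_of_eq_zero _ _ _ rfl _ _
  | succ n =>
    rw [UbgOfRecord₁₃_succ]
    exact bgProvisoΛ_UbgMSOfRecord_of_thm1Scaled h15 (settingOfRecord₁₃ F N θ p) rfl (settingOfRecord₁₃_laws F N θ p)
      (settingOfRecord₁₃_pos F N θ hθ.1.pos p) θ.ν θ.τ9.M p.K (n + 1) θ.s2.cR (hnum p (n + 1) hn hw) ha₀
      (fun m _ hm => alphaPos₁₃_of_inInterval hθ hw hm) (hBα p (n + 1) hn hw) (hloc p (n + 1) hn hw) (h238 p (n + 1) hn hw)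

/-- **THE THIRD NUMERICS CLAUSE FROM THE LETTERS** («proper restrictions on ε_j», [III] p. 259; «C₀ sufficiently large», (2.28)): along a run whose history satisfies
`0 < g_m` and `g_m² ≤ e⁻¹` up to the level `n`, the record's letters with `p₀ ≤ q₀` and `0 ≤ B₃·cR·A₀ ≤ (1 − β)·C₀` give `B₃·cR·ε_m ≤ (1 − β)·α₀(g_m)` for `1 ≤ m ≤ n`.
[cite: Balaban1988Convergent, (2.4) p.255, (2.28) p.259, (2.34) p.261] -/
theorem Stage13Params.bg_numerics_of_letters (θ : Stage13Params F N) {B₃ : ℝ} (hpq : θ.ν.p₀ ≤ (lfOfRecord₁₂ F N θ.toStage12Params).q₀)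
    (hBc : 0 ≤ B₃ * θ.s2.cR * θ.ν.A₀) (hC : B₃ * θ.s2.cR * θ.ν.A₀ ≤ (1 - θ.s2.βc) * (lfOfRecord₁₂ F N θ.toStage12Params).C₀)
    (p : B12.RunParams) (n : ℕ) (hw : ∀ m, m ≤ n → 0 < gOfRecord₁₃ F N θ p m ∧ gOfRecord₁₃ F N θ p m ^ 2 ≤ Real.exp (-1)) :
    ∀ m, 1 ≤ m → m ≤ n →
      B₃ * (θ.s2.cR * epsOfRecord θ.ν (gOfRecord₁₃ F N θ p) m) ≤ (1 - θ.s2.βc) * (lfOfRecord₁₂ F N θ.toStage12Params).alpha0 (gOfRecord₁₃ F N θ p m) :=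
  hBα_of_numerics (lfOfRecord₁₂ F N θ.toStage12Params) θ.ν hw hpq hBc hC

end Literature.MathematicalPhysics.QuantumFieldTheory.Balaban1983to89.Node00

end
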